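import Literature.Computability.Complexity.StackNegacyclic
import Literature.Computability.Complexity.NegacyclicFFTAlgebra
import HarnessLib

/-!
# The negacyclic FFT on residue blocks: the recursive Schönhage–Strassen multiplier and its correctness

Literature / complexity toolkit, continuing `StackNegacyclic.lean` (coefficient vectors,
`listPoly`, the schoolbook negacyclic product `negMul`) and `NegacyclicFFTAlgebra.lean` (the
Cantor–Kaltofen transform over a ring: `fwd`, `inv`, `tconv`, `inv_mul_fwd`).  Part of the
polynomial-arithmetic programme serving the machine of Harvey's deterministic factoring
algorithm (`Cryptography/PQCWave0.lean`, fact `harvey_factoring_one_fifth`).  This file is the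
SPECIFICATION of the fast multiplier the stack machine computes (`StackFFTLevel.lean` and its
sequels execute it pass by pass), on lists of residues modulo `N`, and its correctness:

* blocks: `BlockOK N L u` (length `L`, entries `< N`), the value `ι N L u ∈ D_L = (ℤ/N)[x]/(x^L+1)`
  and the values of the passes of `StackZnVectors.lean` (`ι_vaddMod`, `ι_vsubMod`,
  `ι_vscaleMod`, `ι_negShift`);
* the ℕ-level transforms `bflyN`, `fwdN`, `ibflyN`, `invN` (blocks of length `2m`, twiddle
  exponents, `inv2N N = (N+1)/2`) and **`map_ι_fwdN`**, **`map_ι_invN`**: they compute `fwd`,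
  `inv` of `NegacyclicFFTAlgebra.lean` in `D_{2m}` and keep blocks valid;
* `digits m t f` (the `t` digits of length `m`, zero-padded to `2m`), `overlapAdd` and
  **`listPoly_overlapAdd`** (reassembly modulo `x^{mt} + 1`, an exact identity),
  `listPoly_eq_ev_digits`; `eq_of_mk_eq` (canonical representatives: degree `< L` and congruent
  modulo `x^L + 1` implies equal, `N > 1`), degree bookkeeping;
* **`negMulRec N k f g`** — the recursive negacyclic product of blocks of length `2^k`
  (schoolbook below `2^4`, else digitize, transform, recurse on the `2^{⌊k/2⌋}` leaves of length
  `2^{⌈k/2⌉+1}`, transform back, overlap-add; well-founded on `k`) and **`negMulRec_spec`**: for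
  odd `N > 1`, the result is a valid block with `ι (2^k) (negMulRec N k f g) = ι f · ι g`.

Relation to `AlgebraicComplexity/SchonhageStrassenRecursion.lean` (same day, DFT form on
`ℕ → R`, `negMul_eq_nconv`): the present recursion is on residue LISTS with the operations of
the verified vector passes, so that the machine layers refine it literally.

## References

* A. Schönhage, V. Strassen, *Schnelle Multiplikation großer Zahlen*, Computing 7 (1971) 281–292.
* J. von zur Gathen, J. Gerhard, *Modern Computer Algebra*, 3rd ed., CUP 2013, §8.3, Alg. 8.20,
  Thm. 8.22–8.23. (Folklore material, fully proved here.)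
* D. G. Cantor, E. Kaltofen, Acta Inform. 28 (1991) 693–701.
* D. Harvey, Math. Comp. 90 (2021), §2.2, Lemma 2.1 (`M_N(d)`) [Harvey2021].
-/

namespace Literature.Computability.Complexity

namespace NegFFT

open _root_.Computability Polynomial Finset

/-! ### Blocks of residues and their values in `D = (ℤ/N)[x]/(x^{2m}+1)` -/

/-- `BlockOK N L u`: a block of length `L` with reduced entries. [folklore] -/
def BlockOK (N L : ℕ) (u : List ℕ) : Prop := u.length = L ∧ ∀ a ∈ u, a < N

/-- The value of a block in `(ℤ/N)[x]/(x^L + 1)`. [folklore] -/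
noncomputable def ι (N L : ℕ) (u : List ℕ) : AdjoinRoot (negMod_poly N L) := AdjoinRoot.mk _ (listPoly N u)

variable (N m : ℕ)

/-- The ℕ-level butterfly on a segment of blocks of length `2m` with twiddle exponent `E`:
halves `U`, `W` ↦ `(u + x^E w) ++ (u - x^E w)` blockwise. [folklore] -/
def bflyN (E : ℕ) (Ls : List (List ℕ)) : List (List ℕ) :=
  List.zipWith (fun u w => vaddMod N u (negShift N (2 * m) E w)) (Ls.take (Ls.length / 2)) (Ls.drop (Ls.length / 2)) ++
    List.zipWith (fun u w => vsubMod N u (negShift N (2 * m) E w)) (Ls.take (Ls.length / 2)) (Ls.drop (Ls.length / 2))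

/-- The ℕ-level forward transform. [folklore] -/
def fwdN : ℕ → ℕ → List (List ℕ) → List (List ℕ)
  | _, 0, Ls => Ls
  | F, lv + 1, Ls =>
    fwdN (F / 2) lv ((bflyN N m (F / 2) Ls).take (Ls.length / 2)) ++
      fwdN (F / 2 + 2 * m) lv ((bflyN N m (F / 2) Ls).drop (Ls.length / 2))

/-- The inverse of `2` modulo an odd `N`. [folklore] -/
def inv2N (N : ℕ) : ℕ := (N + 1) / 2

/-- The ℕ-level inverse butterfly: halves `A`, `B` ↦ `(a + b)/2 ++ x^{4m-E} (a - b)/2`. [folklore] -/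
def ibflyN (E : ℕ) (Ms : List (List ℕ)) : List (List ℕ) :=
  List.zipWith (fun a b => vscaleMod N (inv2N N) (vaddMod N a b)) (Ms.take (Ms.length / 2)) (Ms.drop (Ms.length / 2)) ++
    List.zipWith (fun a b => negShift N (2 * m) (4 * m - E) (vscaleMod N (inv2N N) (vsubMod N a b)))
      (Ms.take (Ms.length / 2)) (Ms.drop (Ms.length / 2))

/-- The ℕ-level inverse transform. [folklore] -/
def invN : ℕ → ℕ → List (List ℕ) → List (List ℕ)
  | _, 0, Ms => Ms
  | F, lv + 1, Ms =>
    ibflyN N m (F / 2) (invN (F / 2) lv (Ms.take (Ms.length / 2)) ++ invN (F / 2 + 2 * m) lv (Ms.drop (Ms.length / 2)))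

variable {N m}

/-! ### Entry operations on blocks, valued in `D` -/

section Values

variable {L : ℕ}

/-- Values: modular addition is addition in `D`. [folklore] -/
theorem ι_vaddMod {u v : List ℕ} (hu : u.length = L) (hv : v.length = L) :
    ι N L (vaddMod N u v) = ι N L u + ι N L v := by
  unfold ι; rw [listPoly_vaddMod N (hu.trans hv.symm), map_add]

/-- Values: modular subtraction is subtraction in `D`. [folklore] -/
theorem ι_vsubMod {u v : List ℕ} (hu : u.length = L) (hv : BlockOK N L v) :
    ι N L (vsubMod N u v) = ι N L u - ι N L v := by
  unfold ι; rw [listPoly_vsubMod N (hu.trans hv.1.symm) (fun b hb => (hv.2 b hb).le), map_sub]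

/-- Values: scaling is multiplication by a constant in `D`. [folklore] -/
theorem ι_vscaleMod (c : ℕ) (u : List ℕ) :
    ι N L (vscaleMod N c u) = AdjoinRoot.mk _ (C (c : ZMod N)) * ι N L u := by
  unfold ι; rw [listPoly_vscaleMod, map_mul]

/-- Values: the negacyclic shift is multiplication by a power of the root. [folklore] -/
theorem ι_negShift {u : List ℕ} (hu : BlockOK N L u) {e : ℕ} (he : e < 2 * L) :
    ι N L (negShift N L e u) = AdjoinRoot.root (negMod_poly N L) ^ e * ι N L u := by
  unfold ι; rw [mk_listPoly_negShift N L e hu.1 (fun a ha => (hu.2 a ha).le) he, map_mul, map_pow, AdjoinRoot.mk_X]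

/-- Modular addition keeps blocks valid. [folklore] -/
theorem blockOK_vaddMod {u v : List ℕ} (hN : 0 < N) (hu : u.length = L) (hv : v.length = L) :
    BlockOK N L (vaddMod N u v) :=
  ⟨by rw [length_vaddMod, hu, hv, min_self], fun _ hx => lt_of_mem_vaddMod hN hx⟩

/-- Modular subtraction keeps blocks valid. [folklore] -/
theorem blockOK_vsubMod {u v : List ℕ} (hN : 0 < N) (hu : u.length = L) (hv : v.length = L) :
    BlockOK N L (vsubMod N u v) :=
  ⟨by rw [length_vsubMod, hu, hv, min_self], fun _ hx => lt_of_mem_vsubMod hN hx⟩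

/-- Scaling keeps blocks valid. [folklore] -/
theorem blockOK_vscaleMod {u : List ℕ} (hN : 0 < N) (c : ℕ) (hu : u.length = L) :
    BlockOK N L (vscaleMod N c u) :=
  ⟨by rw [length_vscaleMod, hu], fun _ hx => lt_of_mem_vscaleMod hN hx⟩

/-- The shift keeps blocks valid. [folklore] -/
theorem blockOK_negShift {u : List ℕ} (hN : 0 < N) (hu : BlockOK N L u) (e : ℕ) :
    BlockOK N L (negShift N L e u) :=
  ⟨length_negShift hu.1, fun _ hx => lt_of_mem_negShift hN hu.2 hx⟩

end Values

/-! ### The ℕ-level transforms compute the `D`-level transforms -/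

/-- Congruence of `zipWith` on members. [folklore] -/
theorem zipWith_congr_mem {α β γ : Type*} {f g : α → β → γ} :
    ∀ {l : List α} {l' : List β}, (∀ a ∈ l, ∀ b ∈ l', f a b = g a b) → List.zipWith f l l' = List.zipWith g l l'
  | [], _, _ => by simp
  | _ :: _, [], _ => by simp
  | a :: l, b :: l', h => by
    rw [List.zipWith_cons_cons, List.zipWith_cons_cons, h a (by simp) b (by simp),
      zipWith_congr_mem (fun x hx y hy => h x (by simp [hx]) y (by simp [hy]))]

/-- **The ℕ-level butterfly is the butterfly in `D`** (blocks of length `2m`, `E < 4m`).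
[folklore] -/
theorem map_ι_bflyN (hN : 0 < N) {E : ℕ} (hE : E < 4 * m) {Ls : List (List ℕ)} (hLs : ∀ u ∈ Ls, BlockOK N (2 * m) u) :
    (bflyN N m E Ls).map (ι N (2 * m)) = bfly (AdjoinRoot.root (negMod_poly N (2 * m))) E (Ls.map (ι N (2 * m))) := by
  have htk : ∀ u ∈ Ls.take (Ls.length / 2), BlockOK N (2 * m) u := fun u hu => hLs u (List.mem_of_mem_take hu)
  have hdr : ∀ u ∈ Ls.drop (Ls.length / 2), BlockOK N (2 * m) u := fun u hu => hLs u (List.mem_of_mem_drop hu)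
  have he : E < 2 * (2 * m) := by omega
  unfold bflyN bfly
  rw [List.map_append, List.length_map, ← List.map_take, ← List.map_drop, List.zipWith_map_left, List.zipWith_map_right,
    List.zipWith_map_left, List.zipWith_map_right, List.map_zipWith, List.map_zipWith]
  congr 1
  · refine zipWith_congr_mem fun u hu w hw => ?_
    rw [ι_vaddMod (htk u hu).1 (length_negShift (hdr w hw).1), ι_negShift (hdr w hw) he]
  · refine zipWith_congr_mem fun u hu w hw => ?_
    rw [ι_vsubMod (htk u hu).1 (blockOK_negShift hN (hdr w hw) E), ι_negShift (hdr w hw) he]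

/-- Members of a `zipWith`. [folklore] -/
theorem exists_of_mem_zipWith' {α β γ : Type*} {f : α → β → γ} :
    ∀ {l : List α} {l' : List β} {x : γ}, x ∈ List.zipWith f l l' → ∃ a ∈ l, ∃ b ∈ l', x = f a b
  | [], _, _, h => by simp at h
  | _ :: _, [], _, h => by simp at h
  | a :: l, b :: l', x, h => by
    rw [List.zipWith_cons_cons, List.mem_cons] at h
    rcases h with rfl | h
    · exact ⟨a, by simp, b, by simp, rfl⟩
    · obtain ⟨a', ha', b', hb', rfl⟩ := exists_of_mem_zipWith' h
      exact ⟨a', by simp [ha'], b', by simp [hb'], rfl⟩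

/-- The ℕ-level butterfly keeps blocks valid. [folklore] -/
theorem blockOK_bflyN (hN : 0 < N) (E : ℕ) {Ls : List (List ℕ)} (hLs : ∀ u ∈ Ls, BlockOK N (2 * m) u) :
    ∀ u ∈ bflyN N m E Ls, BlockOK N (2 * m) u := by
  have htk : ∀ u ∈ Ls.take (Ls.length / 2), BlockOK N (2 * m) u := fun u hu => hLs u (List.mem_of_mem_take hu)
  have hdr : ∀ u ∈ Ls.drop (Ls.length / 2), BlockOK N (2 * m) u := fun u hu => hLs u (List.mem_of_mem_drop hu)
  intro u hu
  unfold bflyN at hu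
  rw [List.mem_append] at hu
  rcases hu with hu | hu
  · obtain ⟨a, ha, b, hb, rfl⟩ := exists_of_mem_zipWith' hu
    exact blockOK_vaddMod hN (htk a ha).1 (length_negShift (hdr b hb).1)
  · obtain ⟨a, ha, b, hb, rfl⟩ := exists_of_mem_zipWith' hu
    exact blockOK_vsubMod hN (htk a ha).1 (length_negShift (hdr b hb).1)

/-- The ℕ-level butterfly has the same length. [folklore] -/
theorem length_bflyN (E : ℕ) (Ls : List (List ℕ)) : (bflyN N m E Ls).length = 2 * (Ls.length / 2) := by
  unfold bflyN
  simp only [List.length_append, List.length_zipWith, List.length_take, List.length_drop]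
  omega

/-- **The ℕ-level forward transform is the forward transform in `D`.** [folklore] -/
theorem map_ι_fwdN (hN : 0 < N) : ∀ {F lv : ℕ} {Ls : List (List ℕ)}, F < 4 * m → (∀ u ∈ Ls, BlockOK N (2 * m) u) →
    (fwdN N m F lv Ls).map (ι N (2 * m)) = fwd (AdjoinRoot.root (negMod_poly N (2 * m))) m F lv (Ls.map (ι N (2 * m))) ∧
    ∀ u ∈ fwdN N m F lv Ls, BlockOK N (2 * m) u
  | F, 0, Ls, _, hLs => ⟨rfl, hLs⟩
  | F, lv + 1, Ls, hF, hLs => by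
    have hb := blockOK_bflyN hN (F / 2) hLs
    have htk : ∀ u ∈ (bflyN N m (F / 2) Ls).take (Ls.length / 2), BlockOK N (2 * m) u :=
      fun u hu => hb u (List.mem_of_mem_take hu)
    have hdr : ∀ u ∈ (bflyN N m (F / 2) Ls).drop (Ls.length / 2), BlockOK N (2 * m) u :=
      fun u hu => hb u (List.mem_of_mem_drop hu)
    obtain ⟨e1, b1⟩ := map_ι_fwdN hN (F := F / 2) (lv := lv) (by omega) htk
    obtain ⟨e2, b2⟩ := map_ι_fwdN hN (F := F / 2 + 2 * m) (lv := lv) (by omega) hdr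
    refine ⟨?_, ?_⟩
    · rw [fwdN, fwd, List.map_append, e1, e2, List.map_take, List.map_drop, map_ι_bflyN hN (by omega) hLs, List.length_map]
    · intro u hu
      rw [fwdN, List.mem_append] at hu
      exact hu.elim (b1 u) (b2 u)

/-- The ℕ-level inverse butterfly keeps blocks valid. [folklore] -/
theorem blockOK_ibflyN (hN : 0 < N) (E : ℕ) {Ms : List (List ℕ)} (hMs : ∀ u ∈ Ms, BlockOK N (2 * m) u) :
    ∀ u ∈ ibflyN N m E Ms, BlockOK N (2 * m) u := by
  have htk : ∀ u ∈ Ms.take (Ms.length / 2), BlockOK N (2 * m) u := fun u hu => hMs u (List.mem_of_mem_take hu)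
  have hdr : ∀ u ∈ Ms.drop (Ms.length / 2), BlockOK N (2 * m) u := fun u hu => hMs u (List.mem_of_mem_drop hu)
  intro u hu
  unfold ibflyN at hu
  rw [List.mem_append] at hu
  rcases hu with hu | hu
  · obtain ⟨a, ha, b, hb, rfl⟩ := exists_of_mem_zipWith' hu
    exact blockOK_vscaleMod hN _ (blockOK_vaddMod hN (htk a ha).1 (hdr b hb).1).1
  · obtain ⟨a, ha, b, hb, rfl⟩ := exists_of_mem_zipWith' hu
    exact blockOK_negShift hN (blockOK_vscaleMod hN _ (blockOK_vsubMod hN (htk a ha).1 (hdr b hb).1).1) _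

/-- **The ℕ-level inverse butterfly is the inverse butterfly in `D`** (`1 ≤ E ≤ 4m`, with
`inv2 = ((N+1)/2 : ZMod N)`). [folklore] -/
theorem map_ι_ibflyN (hN : 0 < N) (hm0 : 0 < m) {E : ℕ} (hE1 : 1 ≤ E) {Ms : List (List ℕ)}
    (hMs : ∀ u ∈ Ms, BlockOK N (2 * m) u) :
    (ibflyN N m E Ms).map (ι N (2 * m)) =
      ibfly (AdjoinRoot.root (negMod_poly N (2 * m))) m (AdjoinRoot.mk _ (C ((inv2N N : ℕ) : ZMod N))) E (Ms.map (ι N (2 * m))) := by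
  have htk : ∀ u ∈ Ms.take (Ms.length / 2), BlockOK N (2 * m) u := fun u hu => hMs u (List.mem_of_mem_take hu)
  have hdr : ∀ u ∈ Ms.drop (Ms.length / 2), BlockOK N (2 * m) u := fun u hu => hMs u (List.mem_of_mem_drop hu)
  unfold ibflyN ibfly
  rw [List.map_append, List.length_map, ← List.map_take, ← List.map_drop, List.zipWith_map_left, List.zipWith_map_right,
    List.zipWith_map_left, List.zipWith_map_right, List.map_zipWith, List.map_zipWith]
  congr 1
  · refine zipWith_congr_mem fun a ha b hb => ?_
    rw [ι_vscaleMod, ι_vaddMod (htk a ha).1 (hdr b hb).1]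
  · refine zipWith_congr_mem fun a ha b hb => ?_
    have hsub := blockOK_vsubMod hN (htk a ha).1 (hdr b hb).1
    rw [ι_negShift (blockOK_vscaleMod hN _ hsub.1) (by omega), ι_vscaleMod, ι_vsubMod (htk a ha).1 (hdr b hb)]

/-- **The ℕ-level inverse transform is the inverse transform in `D`** (`2 ≤ F` whenever a
level is split, which `2^lv ∣ F`, `0 < F` guarantee). [folklore] -/
theorem map_ι_invN (hN : 0 < N) (hm0 : 0 < m) : ∀ {F lv : ℕ} {Ms : List (List ℕ)}, 2 ^ lv ∣ F → 2 ^ lv ∣ 4 * m → 0 < F →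
    (∀ u ∈ Ms, BlockOK N (2 * m) u) →
    (invN N m F lv Ms).map (ι N (2 * m)) =
      inv (AdjoinRoot.root (negMod_poly N (2 * m))) m (AdjoinRoot.mk _ (C ((inv2N N : ℕ) : ZMod N))) F lv (Ms.map (ι N (2 * m))) ∧
    ∀ u ∈ invN N m F lv Ms, BlockOK N (2 * m) u
  | F, 0, Ms, _, _, _, hMs => ⟨rfl, hMs⟩
  | F, lv + 1, Ms, hF, hm, hF0, hMs => by
    obtain ⟨hF2, hdvd⟩ := div_two_facts hF
    have hm' : 2 ^ lv ∣ 2 * m := dvd_two_mul_of hm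
    have hm'' : 2 ^ lv ∣ 4 * m := (pow_dvd_pow 2 (Nat.le_succ lv)).trans hm
    have htk : ∀ u ∈ Ms.take (Ms.length / 2), BlockOK N (2 * m) u := fun u hu => hMs u (List.mem_of_mem_take hu)
    have hdr : ∀ u ∈ Ms.drop (Ms.length / 2), BlockOK N (2 * m) u := fun u hu => hMs u (List.mem_of_mem_drop hu)
    obtain ⟨e1, b1⟩ := map_ι_invN hN hm0 (F := F / 2) (lv := lv) hdvd hm'' (by omega) htk
    obtain ⟨e2, b2⟩ := map_ι_invN hN hm0 (F := F / 2 + 2 * m) (lv := lv) (Nat.dvd_add hdvd hm') hm'' (by omega) hdr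
    have hb : ∀ u ∈ invN N m (F / 2) lv (Ms.take (Ms.length / 2)) ++ invN N m (F / 2 + 2 * m) lv (Ms.drop (Ms.length / 2)),
        BlockOK N (2 * m) u := by
      intro u hu; rw [List.mem_append] at hu; exact hu.elim (b1 u) (b2 u)
    refine ⟨?_, ?_⟩
    · rw [invN, inv, map_ι_ibflyN hN hm0 (by omega) hb, List.map_append, e1, e2, List.map_take, List.map_drop, List.length_map]
    · rw [invN]; exact blockOK_ibflyN hN _ hb

/-! ### The inverse of two -/

/-- For odd `N`, `(N+1)/2` is the inverse of `2` modulo `N`. [folklore] -/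
theorem inv2N_mul_two {N : ℕ} (hN : Odd N) : (((inv2N N : ℕ) : ZMod N)) * 2 = 1 := by
  obtain ⟨k, rfl⟩ := hN
  have h : inv2N (2 * k + 1) = k + 1 := by unfold inv2N; omega
  rw [h]
  have : ((2 * k + 1 : ℕ) : ZMod (2 * k + 1)) = 0 := ZMod.natCast_self _
  push_cast at this ⊢
  linear_combination this

/-- `(N+1)/2 < N` for `N > 1`. [folklore] -/
theorem inv2N_lt {N : ℕ} (hN : 1 < N) : inv2N N < N := by unfold inv2N; omega

/-! ### Digits and overlap-add -/

variable (N m)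

/-- The `t` digits of length `m` of a coefficient vector `f` of length `mt`, each padded with
`m` zeros to a block of length `2m`. [folklore] -/
def digits (t : ℕ) (f : List ℕ) : List (List ℕ) :=
  (List.range t).map fun j => (f.drop (j * m)).take m ++ List.replicate m 0

/-- Overlap-add of `t` blocks of length `2m` into a vector of length `mt`, modulo `x^{mt} + 1`:
digit `σ` of the result is `low_σ + high_{σ-1}`, digit `0` is `low_0 - high_{t-1}`. [folklore] -/
def overlapAdd (Cs : List (List ℕ)) : List ℕ :=
  vsubMod N ((Cs.headD []).take m) ((Cs.getLastD []).drop m) ++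
    (List.zipWith (fun c c' => vaddMod N (c.take m) (c'.drop m)) Cs.tail Cs.dropLast).flatten

variable {N m}

/-- There are `t` digits. [folklore] -/
@[simp] theorem length_digits (t : ℕ) (f : List ℕ) : (digits m t f).length = t := by simp [digits]

/-- Digits are valid blocks of length `2m`. [folklore] -/
theorem blockOK_digits {t : ℕ} {f : List ℕ} (hf : BlockOK N (m * t) f) (hN : 0 < N) :
    ∀ u ∈ digits m t f, BlockOK N (2 * m) u := by
  intro u hu
  unfold digits at hu
  rw [List.mem_map] at hu
  obtain ⟨j, hj, rfl⟩ := hu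
  rw [List.mem_range] at hj
  refine ⟨?_, ?_⟩
  · rw [List.length_append, List.length_take, List.length_drop, hf.1, List.length_replicate]
    have : m ≤ m * t - j * m := by
      rw [mul_comm j, ← Nat.mul_sub]; exact Nat.le_mul_of_pos_right _ (by omega)
    omega
  · intro a ha
    rw [List.mem_append] at ha
    rcases ha with ha | ha
    · exact hf.2 a (List.mem_of_mem_drop (List.mem_of_mem_take ha))
    · rw [List.eq_of_mem_replicate ha]; exact hN

/-- `listPoly` of a zero-padded digit. [folklore] -/
theorem listPoly_append_replicate_zero (d : List ℕ) (k : ℕ) : listPoly N (d ++ List.replicate k 0) = listPoly N d := by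
  rw [listPoly_append, listPoly_replicate_zero, mul_zero, add_zero]

/-- **A vector is the evaluation of its digits at `x^m`**: for `|f| = mt`,
`listPoly f = Σ_j x^{mj} · listPoly (digit_j) = ev (X^m) (digit polynomials)`. [folklore] -/
theorem listPoly_eq_ev_digits : ∀ (t : ℕ) {f : List ℕ}, f.length = m * t →
    listPoly N f = ev (X ^ m) ((List.range t).map fun j => listPoly N ((f.drop (j * m)).take m))
  | 0, f, hf => by rw [mul_zero, List.length_eq_zero_iff] at hf; subst hf; simp
  | t + 1, f, hf => by
    have hsplit : f = f.take m ++ f.drop m := (List.take_append_drop m f).symm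
    have hlen : (f.drop m).length = m * t := by rw [List.length_drop, hf]; ring_nf; omega
    rw [List.range_succ_eq_map, List.map_cons, List.map_map, ev_cons]
    conv_lhs => rw [hsplit, listPoly_append, List.length_take, hf, min_eq_left (Nat.le_mul_of_pos_right _ (Nat.succ_pos t))]
    rw [zero_mul, List.drop_zero, listPoly_eq_ev_digits t hlen]
    congr 3
    refine List.map_congr_left fun j _ => ?_
    simp only [Function.comp_apply]
    rw [List.drop_drop, Nat.succ_mul, Nat.add_comm]

/-- `ev` commutes with ring homomorphisms. [folklore] -/
theorem map_ev {S S' : Type*} [CommRing S] [CommRing S'] (φ : S →+* S') (ω : S) (L : List S) :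
    φ (ev ω L) = ev (φ ω) (L.map φ) := by
  induction L with
  | nil => simp
  | cons a L ih => rw [ev_cons, map_add, map_mul, ih, List.map_cons, ev_cons]

/-- `getD 0` through a ring homomorphism. [folklore] -/
theorem Option_getD_map_hom {S S' : Type*} [CommRing S] [CommRing S'] (φ : S →+* S') (o : Option S) :
    (o.map φ).getD 0 = φ (o.getD 0) := by
  cases o <;> simp

/-- The twisted convolution commutes with ring homomorphisms. [folklore] -/
theorem map_tconv {S S' : Type*} [CommRing S] [CommRing S'] (φ : S →+* S') (c : S) (t : ℕ) (A B : List S) :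
    (tconv c t A B).map φ = tconv (φ c) t (A.map φ) (B.map φ) := by
  unfold tconv
  rw [List.map_map]
  refine List.map_congr_left fun σ _ => ?_
  simp only [Function.comp_apply, map_sum, map_add, List.getD_eq_getElem?_getD, List.getElem?_map, Option_getD_map_hom]
  refine Finset.sum_congr rfl fun i _ => Finset.sum_congr rfl fun l _ => ?_
  split_ifs <;> simp

/-- `ev` of a list of sums with a scalar. [folklore] -/
theorem ev_map_add_mul {S α : Type*} [CommRing S] (ω c : S) (f g : α → S) (L : List α) :
    ev ω (L.map fun a => f a + c * g a) = ev ω (L.map f) + c * ev ω (L.map g) := by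
  induction L with
  | nil => simp
  | cons a L ih => simp only [List.map_cons, ev_cons, ih]; ring

/-- `listPoly` of a concatenation of chunks of length `m` is the evaluation at `x^m`. [folklore] -/
theorem listPoly_flatten_eq_ev : ∀ {L : List (List ℕ)}, (∀ c ∈ L, c.length = m) →
    listPoly N L.flatten = ev (X ^ m) (L.map (listPoly N))
  | [], _ => by simp
  | c :: L, h => by
    rw [List.flatten_cons, listPoly_append, h c (by simp), listPoly_flatten_eq_ev (fun d hd => h d (by simp [hd])),
      List.map_cons, ev_cons]

/-- Length of a concatenation of chunks of length `m`. [folklore] -/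
theorem length_flatten_of_forall {α : Type*} {m : ℕ} : ∀ {L : List (List α)}, (∀ c ∈ L, c.length = m) →
    L.flatten.length = m * L.length
  | [], _ => by simp
  | c :: L, h => by
    rw [List.flatten_cons, List.length_append, h c (by simp), length_flatten_of_forall (fun d hd => h d (by simp [hd])),
      List.length_cons]; ring

/-- **Overlap-add reassembles the digits modulo `x^{mt} + 1`**: for `t ≥ 1` blocks `C_σ` of
length `2m` with reduced entries,
`listPoly (overlapAdd Cs) + (x^{mt} + 1) · high_{t-1} = Σ_σ x^{mσ} · listPoly C_σ` exactly.
[von zur Gathen–Gerhard 2013, §8.3] [folklore] -/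
theorem listPoly_overlapAdd {Cs : List (List ℕ)} (hCs : Cs ≠ []) (hB : ∀ c ∈ Cs, BlockOK N (2 * m) c) :
    listPoly N (overlapAdd N m Cs) + (X ^ (m * Cs.length) + 1) * listPoly N ((Cs.getLastD []).drop m) =
      ev (X ^ m) (Cs.map (listPoly N)) := by
  -- lows and highs
  set lows := Cs.map (fun c => listPoly N (c.take m)) with hlows
  set highs := Cs.map (fun c => listPoly N (c.drop m)) with hhighs
  have htake : ∀ c ∈ Cs, (c.take m).length = m := fun c hc => by rw [List.length_take, (hB c hc).1]; omega
  have hdrop : ∀ c ∈ Cs, (c.drop m).length = m := fun c hc => by rw [List.length_drop, (hB c hc).1]; omega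
  -- the blocks are low + x^m high
  have hsplit : Cs.map (listPoly N) = Cs.map (fun c => listPoly N (c.take m) + X ^ m * listPoly N (c.drop m)) := by
    refine List.map_congr_left fun c hc => ?_
    conv_lhs => rw [← List.take_append_drop m c]
    rw [listPoly_append, htake c hc]
  rw [hsplit, ev_map_add_mul]
  -- decompose `Cs = init ++ [last]` and `Cs = head :: tail`
  obtain ⟨c0, Ct, hc0⟩ : ∃ c0 Ct, Cs = c0 :: Ct := List.exists_cons_of_ne_nil hCs
  obtain ⟨Ci, cl, hcl⟩ : ∃ Ci cl, Cs = Ci ++ [cl] := ⟨Cs.dropLast, Cs.getLast hCs, (List.dropLast_append_getLast hCs).symm⟩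
  have hlast : Cs.getLastD [] = cl := by rw [hcl]; simp
  have htl : Cs.tail = Ct := by rw [hc0]; rfl
  have hhd : Cs.headD [] = c0 := by rw [hc0]; rfl
  have hdl : Cs.dropLast = Ci := by rw [hcl, List.dropLast_concat]
  have hlen : Ct.length = Ci.length := by
    have := congrArg List.length hcl; rw [hc0] at this; simp at this; omega
  -- the body of overlap-add
  have hbody : (List.zipWith (fun c c' => vaddMod N (c.take m) (c'.drop m)) Ct Ci).map (listPoly N) =
      List.zipWith (fun p q => p + 1 * q) (Ct.map fun c => listPoly N (c.take m)) (Ci.map fun c => listPoly N (c.drop m)) := by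
    rw [List.map_zipWith, List.zipWith_map_left, List.zipWith_map_right]
    refine zipWith_congr_mem fun c hc c' hc' => ?_
    rw [one_mul, listPoly_vaddMod N ((htake c (by rw [hc0]; simp [hc])).trans (hdrop c' (by rw [hcl]; simp [hc'])).symm)]
  have hbodylen : ∀ d ∈ List.zipWith (fun c c' => vaddMod N (c.take m) (c'.drop m)) Ct Ci, d.length = m := by
    intro d hd
    obtain ⟨c, hc, c', hc', rfl⟩ := exists_of_mem_zipWith' hd
    rw [length_vaddMod, htake c (by rw [hc0]; simp [hc]), hdrop c' (by rw [hcl]; simp [hc']), min_self]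
  unfold overlapAdd
  rw [listPoly_append, length_vsubMod, hhd, hlast, htl, hdl, htake c0 (by rw [hc0]; simp), hdrop cl (by rw [hcl]; simp),
    min_self, listPoly_vsubMod N ((htake c0 (by rw [hc0]; simp)).trans (hdrop cl (by rw [hcl]; simp)).symm)
      (fun b hb => ((hB cl (by rw [hcl]; simp)).2 b (List.mem_of_mem_drop hb)).le),
    listPoly_flatten_eq_ev hbodylen, hbody, ev_zipWith_add_mul _ _ _ _ (by simp [hlen]), one_mul]
  -- ev of lows and highs decomposed
  have hL : ev (X ^ m) lows = listPoly N (c0.take m) + X ^ m * ev (X ^ m) (Ct.map fun c => listPoly N (c.take m)) := by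
    rw [hlows, hc0, List.map_cons, ev_cons]
  have hH : ev (X ^ m) highs = ev (X ^ m) (Ci.map fun c => listPoly N (c.drop m)) + (X ^ m) ^ Ci.length * listPoly N (cl.drop m) := by
    rw [hhighs, hcl, List.map_append, ev_append, List.length_map, List.map_singleton, ev_cons, ev_nil, mul_zero, add_zero]
  have hClen : Cs.length = Ci.length + 1 := by rw [hcl, List.length_append, List.length_singleton]
  rw [← hlows, ← hhighs] at *
  rw [hClen, hL, hH, ← pow_mul, mul_comm m]
  ring

/-! ### Degrees and canonical representatives -/

/-- Polynomials of degree `< L` congruent modulo `x^L + 1` are equal (`N > 1`). [folklore] -/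
theorem eq_of_mk_eq {L : ℕ} (hN1 : 1 < N) {p q : (ZMod N)[X]}
    (h : AdjoinRoot.mk (negMod_poly N L) p = AdjoinRoot.mk (negMod_poly N L) q)
    (hp : p.degree < L) (hq : q.degree < L) : p = q := by
  haveI : Fact (1 < N) := ⟨hN1⟩
  rw [AdjoinRoot.mk_eq_mk] at h
  rcases Nat.eq_zero_or_pos L with rfl | hL
  · have hp0 : p = 0 := Polynomial.degree_eq_bot.1 (by simpa [Nat.cast_zero, WithBot.lt_coe_bot] using hp)
    have hq0 : q = 0 := Polynomial.degree_eq_bot.1 (by simpa [Nat.cast_zero, WithBot.lt_coe_bot] using hq)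
    rw [hp0, hq0]
  have hmonic : (negMod_poly N L).Monic := by
    unfold negMod_poly; rw [← C_1]; exact Polynomial.monic_X_pow_add_C _ (by omega)
  have hdeg : (negMod_poly N L).degree = L := by
    unfold negMod_poly; rw [← C_1, Polynomial.degree_X_pow_add_C hL]
  have h3 : (p - q).degree < (negMod_poly N L).degree :=
    hdeg ▸ (Polynomial.degree_sub_le _ _).trans_lt (max_lt hp hq)
  have e1 : (p - q) %ₘ negMod_poly N L = p - q := (Polynomial.modByMonic_eq_self_iff hmonic).2 h3
  have e2 : (p - q) %ₘ negMod_poly N L = 0 := (Polynomial.modByMonic_eq_zero_iff_dvd hmonic).2 h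
  exact sub_eq_zero.1 (e1.symm.trans e2)

/-- A product of polynomials of degrees `< m` has degree `< 2m`. [folklore] -/
theorem degree_mul_lt_two_mul {p q : (ZMod N)[X]} (hp : p.degree < m) (hq : q.degree < m) : (p * q).degree < (2 * m : ℕ) := by
  rcases eq_or_ne p 0 with rfl | hp0
  · rw [zero_mul, degree_zero]; exact WithBot.bot_lt_coe _
  rcases eq_or_ne q 0 with rfl | hq0
  · rw [mul_zero, degree_zero]; exact WithBot.bot_lt_coe _
  refine (Polynomial.degree_mul_le p q).trans_lt ?_
  rw [Polynomial.degree_eq_natDegree hp0] at hp ⊢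
  rw [Polynomial.degree_eq_natDegree hq0] at hq ⊢
  have hp' : p.natDegree < m := by exact_mod_cast hp
  have hq' : q.natDegree < m := by exact_mod_cast hq
  exact_mod_cast (show p.natDegree + q.natDegree < 2 * m by omega)

/-- A finite sum of polynomials of degree `< n` has degree `< n`. [folklore] -/
theorem degree_sum_lt {ι' : Type*} (s : Finset ι') (f : ι' → (ZMod N)[X]) {n : ℕ}
    (h : ∀ i ∈ s, (f i).degree < n) : (∑ i ∈ s, f i).degree < n :=
  (Polynomial.degree_sum_le s f).trans_lt ((Finset.sup_lt_iff (WithBot.bot_lt_coe n)).2 h)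

/-- The entries of the twisted convolution of digit polynomials (degrees `< m`) have degree
`< 2m`. [folklore] -/
theorem degree_getD_tconv_lt {t : ℕ} {Fp Gp : List (ZMod N)[X]} (hF : ∀ p ∈ Fp, p.degree < m)
    (hG : ∀ p ∈ Gp, p.degree < m) (σ : ℕ) : ((tconv (-1) t Fp Gp).getD σ 0).degree < (2 * m : ℕ) := by
  have hgetD : ∀ (L : List (ZMod N)[X]), (∀ p ∈ L, p.degree < m) → ∀ i, (L.getD i 0).degree < m := by
    intro L hL i
    rw [List.getD_eq_getElem?_getD]
    cases h : L[i]? with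
    | none => rw [Option.getD_none, degree_zero]; exact WithBot.bot_lt_coe m
    | some p => exact hL p (List.mem_of_getElem? h)
  by_cases hσ : σ < t
  · rw [getD_tconv _ _ _ _ hσ]
    refine degree_sum_lt _ _ fun i _ => degree_sum_lt _ _ fun l _ => ?_
    refine (Polynomial.degree_add_le _ _).trans_lt (max_lt ?_ ?_)
    · split_ifs
      · exact degree_mul_lt_two_mul (hgetD Fp hF i) (hgetD Gp hG l)
      · rw [degree_zero]; exact WithBot.bot_lt_coe _
    · split_ifs
      · rw [neg_one_mul, Polynomial.degree_neg]; exact degree_mul_lt_two_mul (hgetD Fp hF i) (hgetD Gp hG l)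
      · rw [degree_zero]; exact WithBot.bot_lt_coe _
  · rw [List.getD_eq_default _ _ (by rw [length_tconv]; omega), degree_zero]
    exact WithBot.bot_lt_coe _

/-! ### The recursive negacyclic multiplier -/

variable (N)

/-- **The Cantor–Kaltofen / Schönhage–Strassen negacyclic product** of two blocks of length
`2^k` with reduced entries: schoolbook below `2^4`, otherwise digitize into `t = 2^{⌊k/2⌋}`
blocks of length `2m = 2^{⌈k/2⌉+1}`, transform both, multiply the leaves recursively,
transform back and overlap-add. [von zur Gathen–Gerhard 2013, Alg. 8.20; Cantor–Kaltofen 1991;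
Schönhage–Strassen 1971] [folklore] -/
def negMulRec : ℕ → List ℕ → List ℕ → List ℕ
  | k, f, g =>
    if hk : k ≤ 3 then negMul N (2 ^ k) f g
    else
      overlapAdd N (2 ^ ((k + 1) / 2)) (invN N (2 ^ ((k + 1) / 2)) (2 * 2 ^ ((k + 1) / 2)) (k / 2)
        (List.zipWith (fun a b => negMulRec ((k + 1) / 2 + 1) a b)
          (fwdN N (2 ^ ((k + 1) / 2)) (2 * 2 ^ ((k + 1) / 2)) (k / 2) (digits (2 ^ ((k + 1) / 2)) (2 ^ (k / 2)) f))
          (fwdN N (2 ^ ((k + 1) / 2)) (2 * 2 ^ ((k + 1) / 2)) (k / 2) (digits (2 ^ ((k + 1) / 2)) (2 ^ (k / 2)) g))))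
  termination_by k => k
  decreasing_by omega

variable {N}

/-- Overlap-add yields a valid block of length `m · t`. [folklore] -/
theorem blockOK_overlapAdd (hN0 : 0 < N) {Cs : List (List ℕ)} (hCs : Cs ≠ []) (hB : ∀ c ∈ Cs, BlockOK N (2 * m) c) :
    BlockOK N (m * Cs.length) (overlapAdd N m Cs) := by
  obtain ⟨c0, Ct, hc0⟩ : ∃ c0 Ct, Cs = c0 :: Ct := List.exists_cons_of_ne_nil hCs
  obtain ⟨Ci, cl, hcl⟩ : ∃ Ci cl, Cs = Ci ++ [cl] := ⟨Cs.dropLast, Cs.getLast hCs, (List.dropLast_append_getLast hCs).symm⟩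
  have htake : ∀ c ∈ Cs, (c.take m).length = m := fun c hc => by rw [List.length_take, (hB c hc).1]; omega
  have hdrop : ∀ c ∈ Cs, (c.drop m).length = m := fun c hc => by rw [List.length_drop, (hB c hc).1]; omega
  have hlast : Cs.getLastD [] = cl := by rw [hcl]; simp
  have htl : Cs.tail = Ct := by rw [hc0]; rfl
  have hhd : Cs.headD [] = c0 := by rw [hc0]; rfl
  have hdl : Cs.dropLast = Ci := by rw [hcl, List.dropLast_concat]
  have hlen : Ct.length = Ci.length := by
    have := congrArg List.length hcl; rw [hc0] at this; simp at this; omega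
  have hbodylen : ∀ d ∈ List.zipWith (fun c c' => vaddMod N (c.take m) (c'.drop m)) Ct Ci, d.length = m := by
    intro d hd
    obtain ⟨c, hc, c', hc', rfl⟩ := exists_of_mem_zipWith' hd
    rw [length_vaddMod, htake c (by rw [hc0]; simp [hc]), hdrop c' (by rw [hcl]; simp [hc']), min_self]
  refine ⟨?_, ?_⟩
  · unfold overlapAdd
    rw [List.length_append, length_vsubMod, hhd, hlast, htl, hdl, htake c0 (by rw [hc0]; simp),
      hdrop cl (by rw [hcl]; simp), min_self, length_flatten_of_forall hbodylen, List.length_zipWith, hlen, min_self,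
      hc0, List.length_cons, hlen]
    ring
  · intro x hx
    unfold overlapAdd at hx
    rw [List.mem_append, List.mem_flatten] at hx
    rcases hx with hx | ⟨d, hd, hx⟩
    · exact lt_of_mem_vsubMod hN0 hx
    · obtain ⟨c, -, c', -, rfl⟩ := exists_of_mem_zipWith' hd
      exact lt_of_mem_vaddMod hN0 hx

/-- The level parameters: `2^k = 2^{⌈k/2⌉} · 2^{⌊k/2⌋}`. [folklore] -/
theorem two_pow_split (k : ℕ) : 2 ^ k = 2 ^ ((k + 1) / 2) * 2 ^ (k / 2) := by
  rw [← pow_add]; congr 1; omega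

/-- **Correctness of the recursive negacyclic multiplier.** For odd `N > 1` and blocks `f`, `g`
of length `2^k` with reduced entries, `negMulRec N k f g` is a block of length `2^k` with reduced
entries whose polynomial is `f · g` in `(ℤ/N)[x]/(x^{2^k} + 1)`.
[von zur Gathen–Gerhard 2013, Thm. 8.23; Schönhage–Strassen 1971] [folklore] -/
theorem negMulRec_spec (hNodd : Odd N) (hN1 : 1 < N) (k : ℕ) : ∀ {f g : List ℕ},
    BlockOK N (2 ^ k) f → BlockOK N (2 ^ k) g →
    BlockOK N (2 ^ k) (negMulRec N k f g) ∧ ι N (2 ^ k) (negMulRec N k f g) = ι N (2 ^ k) f * ι N (2 ^ k) g := by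
  induction k using Nat.strong_induction_on with
  | _ k IH =>
  intro f g hf hg
  have hN0 : 0 < N := by omega
  rw [negMulRec]
  split_ifs with hk
  · -- schoolbook
    refine ⟨⟨length_negMul f hg.1, fun x hx => lt_of_mem_negMul hN0 f g hx⟩, ?_⟩
    unfold ι
    exact mk_listPoly_negMul N (2 ^ k) (by rw [hf.1]; omega) hg.1 hg.2
  · -- one level of the transform
    set a := (k + 1) / 2 with ha
    set lv := k / 2 with hlv
    set m := 2 ^ a with hm
    set t := 2 ^ lv with ht
    have hK : 2 ^ k = m * t := by rw [hm, ht]; exact two_pow_split k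
    have hm0 : 0 < m := by rw [hm]; positivity
    have ht0 : 0 < t := by rw [ht]; positivity
    have hk' : a + 1 < k := by omega
    have h2m : 2 * m = 2 ^ (a + 1) := by rw [hm, pow_succ]; ring
    have hdvd2 : 2 ^ lv ∣ 2 * m := by rw [h2m]; exact pow_dvd_pow 2 (by omega)
    have hdvd4 : 2 ^ lv ∣ 4 * m := by rw [show 4 * m = 2 * (2 * m) by ring]; exact dvd_mul_of_dvd_right hdvd2 2
    -- digits
    have hdf := blockOK_digits (N := N) (m := m) (t := t) (f := f) (by rw [← hK]; exact hf) hN0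
    have hdg := blockOK_digits (N := N) (m := m) (t := t) (f := g) (by rw [← hK]; exact hg) hN0
    -- forward transforms
    obtain ⟨eA, bA⟩ := map_ι_fwdN (N := N) (m := m) hN0 (F := 2 * m) (lv := lv) (Ls := digits m t f) (by omega) hdf
    obtain ⟨eB, bB⟩ := map_ι_fwdN (N := N) (m := m) hN0 (F := 2 * m) (lv := lv) (Ls := digits m t g) (by omega) hdg
    set A := fwdN N m (2 * m) lv (digits m t f) with hA
    set B := fwdN N m (2 * m) lv (digits m t g) with hB
    -- the leaves, by induction
    set P := List.zipWith (fun u w => negMulRec N (a + 1) u w) A B with hP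
    have hIH : ∀ u ∈ A, ∀ w ∈ B, BlockOK N (2 * m) (negMulRec N (a + 1) u w) ∧
        ι N (2 * m) (negMulRec N (a + 1) u w) = ι N (2 * m) u * ι N (2 * m) w := by
      intro u hu w hw
      rw [h2m]
      exact IH (a + 1) hk' (h2m ▸ bA u hu) (h2m ▸ bB w hw)
    have bP : ∀ p ∈ P, BlockOK N (2 * m) p := by
      intro p hp
      obtain ⟨u, hu, w, hw, rfl⟩ := exists_of_mem_zipWith' hp
      exact (hIH u hu w hw).1
    have eP : P.map (ι N (2 * m)) = List.zipWith (· * ·) (A.map (ι N (2 * m))) (B.map (ι N (2 * m))) := by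
      rw [hP, List.map_zipWith, List.zipWith_map_left, List.zipWith_map_right]
      exact zipWith_congr_mem fun u hu w hw => (hIH u hu w hw).2
    -- inverse transform
    obtain ⟨eC, bC⟩ := map_ι_invN (N := N) (m := m) hN0 hm0 (F := 2 * m) (lv := lv) (Ms := P) hdvd2 hdvd4 (by omega) bP
    set Cs := invN N m (2 * m) lv P with hCs
    -- the transform multiplies, in `D`
    set ψ := AdjoinRoot.root (negMod_poly N (2 * m)) with hψd
    have hψ : ψ ^ (2 * m) = -1 := by
      rw [hψd, ← AdjoinRoot.mk_X, ← map_pow]; exact AdjoinRoot_mk_X_pow N (2 * m)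
    have h2 : AdjoinRoot.mk (negMod_poly N (2 * m)) (C ((inv2N N : ℕ) : ZMod N)) * 2 = 1 := by
      have e2 : (2 : AdjoinRoot (negMod_poly N (2 * m))) = AdjoinRoot.mk _ (C 2) := by
        rw [Polynomial.C_ofNat, map_ofNat]
      rw [e2, ← map_mul, ← C_mul, inv2N_mul_two hNodd, C_1, map_one]
    have hlA : ((digits m t f).map (ι N (2 * m))).length = 2 ^ lv := by rw [List.length_map, length_digits, ht]
    have hlB : ((digits m t g).map (ι N (2 * m))).length = 2 ^ lv := by rw [List.length_map, length_digits, ht]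
    have key := inv_mul_fwd (ψ := ψ) (m := m) hψ _ h2 (F := 2 * m) (lv := lv) hdvd2 hdvd4 (by omega) hlA hlB
    have hC : Cs.map (ι N (2 * m)) = tconv (-1) t ((digits m t f).map (ι N (2 * m))) ((digits m t g).map (ι N (2 * m))) := by
      rw [eC, eP, eA, eB, key, hψ, ht]
    -- the same, exactly, for polynomials
    set Fp := (digits m t f).map (listPoly N) with hFp
    set Gp := (digits m t g).map (listPoly N) with hGp
    have hιF : (digits m t f).map (ι N (2 * m)) = Fp.map (AdjoinRoot.mk (negMod_poly N (2 * m))) := by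
      rw [hFp, List.map_map]; rfl
    have hιG : (digits m t g).map (ι N (2 * m)) = Gp.map (AdjoinRoot.mk (negMod_poly N (2 * m))) := by
      rw [hGp, List.map_map]; rfl
    set T := tconv (-1 : (ZMod N)[X]) t Fp Gp with hTd
    have hT : T.map (AdjoinRoot.mk (negMod_poly N (2 * m))) = Cs.map (ι N (2 * m)) := by
      rw [hC, hTd, map_tconv, map_neg, map_one, hιF, hιG]
    have hdegdig : ∀ (h : List ℕ), ∀ p ∈ (digits m t h).map (listPoly N), p.degree < m := by
      intro h p hp
      rw [List.mem_map] at hp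
      obtain ⟨d, hd, rfl⟩ := hp
      unfold digits at hd
      rw [List.mem_map] at hd
      obtain ⟨jj, -, rfl⟩ := hd
      rw [listPoly_append_replicate_zero]
      refine (degree_listPoly_lt N _).trans_le ?_
      exact_mod_cast List.length_take_le m _
    have hlenA : A.length = t := by
      have := congrArg List.length eA; rwa [List.length_map, length_fwd _ _ hlA, ← ht] at this
    have hlenB : B.length = t := by
      have := congrArg List.length eB; rwa [List.length_map, length_fwd _ _ hlB, ← ht] at this
    have hlenP : P.length = t := by rw [hP, List.length_zipWith, hlenA, hlenB, min_self]
    have hlenC : Cs.length = t := by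
      have := congrArg List.length eC
      rwa [List.length_map, length_inv _ _ _ (by rw [List.length_map, hlenP, ht]), ← ht] at this
    have hCT : Cs.map (listPoly N) = T := by
      refine List.ext_getElem (by rw [List.length_map, hlenC, hTd, length_tconv]) fun i h1 h2 => ?_
      have hiC : i < Cs.length := by simpa using h1
      have e : AdjoinRoot.mk (negMod_poly N (2 * m)) (T.getD i 0) =
          AdjoinRoot.mk (negMod_poly N (2 * m)) (listPoly N (Cs.getD i [])) := by
        have : (T.map (AdjoinRoot.mk (negMod_poly N (2 * m)))).getD i 0 = (Cs.map (ι N (2 * m))).getD i 0 := by rw [hT]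
        rw [List.getD_eq_getElem?_getD, List.getElem?_map, List.getElem?_eq_getElem h2, Option.map_some, Option.getD_some,
          List.getD_eq_getElem?_getD, List.getElem?_map, List.getElem?_eq_getElem hiC, Option.map_some, Option.getD_some] at this
        rw [List.getD_eq_getElem _ _ h2, List.getD_eq_getElem _ _ hiC]; exact this
      have hdegC : (listPoly N (Cs.getD i [])).degree < (2 * m : ℕ) := by
        have := degree_listPoly_lt N (Cs.getD i [])
        rwa [List.getD_eq_getElem _ _ hiC, (bC _ (List.getElem_mem hiC)).1, ← List.getD_eq_getElem _ _ hiC] at this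
      have := eq_of_mk_eq hN1 e (hTd ▸ degree_getD_tconv_lt (hdegdig f) (hdegdig g) i) hdegC
      rw [List.getElem_map, ← List.getD_eq_getElem _ [] hiC, ← this, List.getD_eq_getElem _ _ h2]
    -- overlap-add
    have hCne : Cs ≠ [] := List.ne_nil_of_length_pos (by rw [hlenC]; exact ht0)
    have hOK := blockOK_overlapAdd (N := N) (m := m) hN0 hCne bC
    rw [hlenC, ← hK] at hOK
    refine ⟨hOK, ?_⟩
    have hOA := listPoly_overlapAdd (N := N) (m := m) hCne bC
    rw [hlenC, ← hK, hCT] at hOA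
    -- push to `D_K`
    set φ := AdjoinRoot.mk (negMod_poly N (2 ^ k)) with hφ
    have hkill : φ (X ^ (2 ^ k) + 1) = 0 := AdjoinRoot.mk_self
    have hω : φ (X ^ m) ^ t = -1 := by
      rw [← map_pow, ← pow_mul, ← hK]
      have := AdjoinRoot_mk_X_pow N (2 ^ k); exact this
    have hlF : (Fp.map φ).length = t := by rw [List.length_map, hFp, List.length_map, length_digits]
    have hlG : (Gp.map φ).length = t := by rw [List.length_map, hGp, List.length_map, length_digits]
    have hevf : listPoly N f = ev (X ^ m) Fp := by
      rw [listPoly_eq_ev_digits (N := N) (m := m) t (hf.1.trans hK), hFp]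
      unfold digits
      rw [List.map_map]
      congr 1
      refine List.map_congr_left fun jj _ => ?_
      simp only [Function.comp_apply, listPoly_append_replicate_zero]
    have hevg : listPoly N g = ev (X ^ m) Gp := by
      rw [listPoly_eq_ev_digits (N := N) (m := m) t (hg.1.trans hK), hGp]
      unfold digits
      rw [List.map_map]
      congr 1
      refine List.map_congr_left fun jj _ => ?_
      simp only [Function.comp_apply, listPoly_append_replicate_zero]
    unfold ι
    rw [← hφ]
    calc φ (listPoly N (overlapAdd N m Cs))
        = φ (listPoly N (overlapAdd N m Cs) + (X ^ (2 ^ k) + 1) * listPoly N ((Cs.getLastD []).drop m)) := by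
          rw [map_add, map_mul, hkill, zero_mul, add_zero]
      _ = φ (ev (X ^ m) T) := by rw [hOA]
      _ = ev (φ (X ^ m)) (Fp.map φ) * ev (φ (X ^ m)) (Gp.map φ) := by
          rw [map_ev, hTd, map_tconv, map_neg, map_one, ev_tconv _ _ hω hlF hlG]
      _ = φ (listPoly N f) * φ (listPoly N g) := by rw [hevf, hevg, map_ev, map_ev]

end NegFFT

end Literature.Computability.Complexity
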